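import Literature.AlgebraicGeometry.Surfaces.NikulinLattice
import Literature.AlgebraicGeometry.Surfaces.EnriquesInvolutionK3Lattice
import Literature.Topology.FourManifolds.LatticeFormsOverlatticeSignature
import Literature.Topology.FourManifolds.LatticeFormsOrthoSumSignature
import Literature.Topology.FourManifolds.LatticeFormsDefinite
import HarnessLib

/-!
# van Geemen–Sarti's Lemma 1.10: `U(2)^{⊕3} ⊕ N` glued by six half-vectors is `U^{⊕3} ⊕ E₈(−1)`

[cite: VanGeemenSarti2007, §1.10 (Lemma 1.10)]

Van Geemen–Sarti, *Nikulin involutions on K3 surfaces*, Lemma 1.10: "The sublattice of `(U(2)³ ⊕ N) ⊗ ℚ`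
generated by `U(2)³ ⊕ N` and the following six elements, each divided by two, is isomorphic to `U³ ⊕ E₈(−1)`:
`e₁ + (N₁+N₂+N₃+N₈)`, `e₂ + (N₁+N₅+N₆+N₈)`, `e₃ + (N₂+N₆+N₇+N₈)`, `f₁ + (N₁+N₂+N₄+N₈)`, `f₂ + (N₁+N₅+N₇+N₈)`,
`f₃ + (N₃+N₄+N₅+N₈)`, here `eᵢ, fᵢ` are the standard basis of the `i`-th copy of `U(2)` in `U(2)³`." (`N` the
Nikulin lattice `⟨N₁, …, N₈, (ΣNᵢ)/2⟩`, §1.5.)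

## What is here (the `Λ^*`-model of `LatticeFormsOverlattices.lean`, as in `KummerLattice.lean` / `NikulinLattice.lean`)

The base lattice is `Λ₀ = U(2)^{⊕3} ⊕ ⟨−2⟩^{⊕8} = (U^{⊕3} ⊕ ⟨−1⟩^{⊕8})(2)` on
`VGSCarrier = (ℤ³ × ℤ³) × ℤ⁸` (`vgsNodeForm = 2 • vgsBaseForm`; the `e`-, `f`- and `N`-coordinates), whose
discriminant group is `Λ₀^*/Λ₀ ≅ 𝔽₂^{14}` by the residue map `r` (`vgsResidue`, from
`LatticeFormsTwistDiscriminantGroup.lean`). A half-vector `w/2`, `w ∈ Λ₀' = U^{⊕3} ⊕ ℤ⁸`, is the functional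
`vgsBaseForm w ∈ Λ₀^*`. The van Geemen–Sarti lattice `vgsLattice` is generated over `Λ₀` by the SEVEN
half-vectors `N̂ = (ΣNᵢ)/2` (so that `Λ₀ + ℤN̂ = U(2)^{⊕3} ⊕ N`) and the six printed ones (`vgsGlueVec`).
* §1 `Λ₀`: unimodular base, `|A_{Λ₀}| = 2¹⁴`, `σ(Λ₀) = −8` (`U(2)^{⊕3} ≃ U(2)^{⊕3}(−1)` has signature `0`,
  `⟨−2⟩^{⊕8}` is negative definite).
* §2 the seven glue vectors, their residues `vgsGen k ∈ 𝔽₂^{14}`, the binary code `vgsCode` they span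
  (`|vgsCode| = 2⁷`: the generators are independent, `vgsWord_injective`, a finite check) and its
  `q`-isotropy `4 ∣ 2 e·f − #nodes` on all `128` words (`four_dvd_vgsWord`, a finite check).
* §3 `vgsLattice`, `H = vgsLattice/Λ₀`, `r(H) = vgsCode`, `|H| = 2⁷`, `q_{Λ₀}|_H = 0`.
* §4 **the lattice `Γ = vgsOverlatticeForm`** (integral form on `vgsLattice`): even, **unimodular**
  (`|H|² = 2¹⁴ = |A_{Λ₀}|`), of rank `14`, signature `−8`, indefinite; hence, by Milnor's classification
  (`exists_equivalent_pi_neg_e8Form_prod_hyperbolicSum`), **Lemma 1.10: `Γ ≃ E₈(−1) ⊕ U^{⊕3}`**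
  (`vgsOverlatticeForm_equivalent`, in the lattice files' model `(pi fun _ : Fin 1 ↦ -e8Form).prod (hyperbolicSum 3)`).

* §5 **"such that the image of `N` is primitive"**: `Γ ∩ N_ℚ = N` — a node-supported half-vector `(Σ nⱼNⱼ)/2`
  lies in `Γ` iff all `nⱼ` are even or all are odd (`vgsBaseForm_nodes_mem_vgsLattice_iff`; the code words with
  vanishing `U`-part are `0` and `r(N̂)`, a finite check).

NOT here: the uniqueness clause ("Any embedding … is isometric to this embedding").
-/

noncomputable section

open Module Function Matrix
open LinearMap (BilinForm)
open LinearMap.BilinForm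
open Literature.Topology.FourManifolds

namespace Literature.AlgebraicGeometry.Surfaces

/-! ### §1 The base lattice `Λ₀ = U(2)^{⊕3} ⊕ ⟨−2⟩^{⊕8} = (U^{⊕3} ⊕ ⟨−1⟩^{⊕8})(2)` -/

/-- Carrier of `U^{⊕3} ⊕ ℤ⁸`: `((e-coordinates, f-coordinates), N-coordinates)`. [cite: VanGeemenSarti2007, §1.10 ("`eᵢ, fᵢ` are the standard basis of the `i`-th copy of `U(2)` in `U(2)³`")] -/
abbrev VGSCarrier : Type := ((Fin 3 → ℤ) × (Fin 3 → ℤ)) × (Fin 8 → ℤ)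

/-- Index set of the coordinates: `(eᵢ)ᵢ ⊔ (fᵢ)ᵢ ⊔ (Nⱼ)ⱼ`. [cite: VanGeemenSarti2007, §1.10] -/
abbrev VGSIndex : Type := (Fin 3 ⊕ Fin 3) ⊕ Fin 8

/-- The coordinates of a vector. [cite: VanGeemenSarti2007, §1.10] -/
def vgsCoord (p : VGSCarrier) : VGSIndex → ℤ :=
  Sum.elim (Sum.elim p.1.1 p.1.2) p.2

/-- The coordinate basis of `VGSCarrier`. [cite: VanGeemenSarti2007, §1.10] -/
def vgsBasis : Basis VGSIndex ℤ VGSCarrier :=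
  ((Pi.basisFun ℤ (Fin 3)).prod (Pi.basisFun ℤ (Fin 3))).prod (Pi.basisFun ℤ (Fin 8))

/-- The basis reads off the coordinates. [cite: VanGeemenSarti2007, §1.10] -/
theorem vgsBasis_repr (p : VGSCarrier) (i : VGSIndex) : vgsBasis.repr p i = vgsCoord p i := by
  rcases i with (i | i) | j
  · rw [vgsBasis, Basis.prod_repr_inl, Basis.prod_repr_inl, Pi.basisFun_repr]; rfl
  · rw [vgsBasis, Basis.prod_repr_inl, Basis.prod_repr_inr, Pi.basisFun_repr]; rfl
  · rw [vgsBasis, Basis.prod_repr_inr, Pi.basisFun_repr]; rfl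

/-- **The unimodular lattice `Λ₀' = U^{⊕3} ⊕ ⟨−1⟩^{⊕8}`** (its twist by `2` is `U(2)^{⊕3} ⊕ ⟨−2⟩^{⊕8}`).
[cite: VanGeemenSarti2007, §1.10] [cite: Huybrechts2016K3, Ch. 14 §0.3 (iv)] -/
def vgsBaseForm : BilinForm ℤ VGSCarrier :=
  (hyperbolicSum 3).prod nikulinBaseForm

/-- `Λ₀'` evaluated: `((u,v),n) . ((u',v'),n')) = u·v' + v·u' − n·n'`. [cite: VanGeemenSarti2007, §1.10] -/
theorem vgsBaseForm_apply (p q : VGSCarrier) :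
    vgsBaseForm p q = p.1.1 ⬝ᵥ q.1.2 + p.1.2 ⬝ᵥ q.1.1 + -(p.2 ⬝ᵥ q.2) := by
  rw [vgsBaseForm, LinearMap.BilinForm.prod_apply, hyperbolicSum_apply, nikulinBaseForm_apply]

/-- `Λ₀'` is unimodular. [cite: Huybrechts2016K3, Ch. 14 §0.3 (i)] -/
theorem isUnimodular_vgsBaseForm : vgsBaseForm.IsUnimodular :=
  isUnimodular_prod_iff.2 ⟨isUnimodular_hyperbolicSum 3, isUnimodular_nikulinBaseForm⟩

/-- `Λ₀'` is symmetric. [cite: Huybrechts2016K3, Ch. 14 §0.3] -/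
theorem isSymm_vgsBaseForm : vgsBaseForm.IsSymm :=
  ⟨fun p q ↦ by rw [vgsBaseForm_apply, vgsBaseForm_apply, dotProduct_comm p.1.1, dotProduct_comm p.1.2,
    dotProduct_comm p.2]; ring⟩

/-- `Λ₀'` is nondegenerate. [cite: Huybrechts2016K3, Ch. 14 §0.1] -/
theorem nondegenerate_vgsBaseForm : vgsBaseForm.Nondegenerate :=
  isUnimodular_vgsBaseForm.nondegenerate

/-- **`Λ₀ = U(2)^{⊕3} ⊕ ⟨−2⟩^{⊕8} = U(2)^{⊕3} ⊕ (⊕ ℤNᵢ)`**, the twist `Λ₀'(2)`. [cite: VanGeemenSarti2007, §1.10 ("`U(2)³ ⊕ N`", `N ⊃ ⟨−2⟩⁸`)] -/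
abbrev vgsNodeForm : BilinForm ℤ VGSCarrier := (2 : ℤ) • vgsBaseForm

/-- `Λ₀ = U(2)^{⊕3} ⊕ ⟨−2⟩^{⊕8}` as an orthogonal sum of twists. [cite: VanGeemenSarti2007, §1.10] -/
theorem vgsNodeForm_eq_prod : vgsNodeForm = ((2 : ℤ) • hyperbolicSum 3).prod nikulinNodeForm :=
  smul_prod _ _ 2

/-- `Λ₀` is symmetric. [cite: VanGeemenSarti2007, §1.10] -/
theorem isSymm_vgsNodeForm : vgsNodeForm.IsSymm :=
  vgsBaseForm.isSymm_smul_of_isSymm 2 isSymm_vgsBaseForm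

/-- `Λ₀` is nondegenerate. [cite: VanGeemenSarti2007, §1.10] -/
theorem nondegenerate_vgsNodeForm : vgsNodeForm.Nondegenerate :=
  (vgsBaseForm.nondegenerate_zsmul_iff two_ne_zero).2 nondegenerate_vgsBaseForm

/-- `Λ₀` is even. [cite: VanGeemenSarti2007, §1.10] -/
theorem isEven_vgsNodeForm : vgsNodeForm.IsEven := fun p ↦ ⟨vgsBaseForm p p, by rw [smul_apply_apply]; ring⟩

/-- `|A_{Λ₀}| = 2¹⁴`. [cite: VanGeemenSarti2007, §1.10] [cite: Huybrechts2016K3, Ch. 14 §0.3 (iv)] -/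
theorem natCard_discriminantGroup_vgsNodeForm : Nat.card vgsNodeForm.discriminantGroup = 2 ^ 14 := by
  rw [vgsBaseForm.natCard_discriminantGroup_smul_of_isUnimodular 2 isUnimodular_vgsBaseForm vgsBasis]
  simp

/-- `rk Λ₀ = 14`. [cite: VanGeemenSarti2007, §1.10] -/
theorem finrank_vgsCarrier : finrank ℤ VGSCarrier = 14 := by
  simp [Module.finrank_prod]

/-- **`U(2)^{⊕3} ≃ U(2)^{⊕3}(−1)`** by `(u, v) ↦ (u, −v)`. [cite: Huybrechts2016K3, Ch. 14 §0.3 (ii) ("`U ≃ U(−1)`")] -/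
def twoHyperbolicSumNegIsometryEquiv : ((2 : ℤ) • hyperbolicSum 3).IsometryEquiv (-((2 : ℤ) • hyperbolicSum 3)) :=
  { (LinearEquiv.refl ℤ (Fin 3 → ℤ)).prodCongr (LinearEquiv.neg ℤ) with
    map_app' := fun p q ↦ by
      change -(((2 : ℤ) • hyperbolicSum 3) (p.1, -p.2) (q.1, -q.2)) = ((2 : ℤ) • hyperbolicSum 3) p q
      rw [smul_apply_apply, smul_apply_apply, hyperbolicSum_apply, hyperbolicSum_apply]
      simp only [dotProduct_neg, neg_dotProduct]
      ring }

/-- **`σ(U(2)^{⊕3}) = 0`.** [cite: Huybrechts2016K3, Ch. 14 §0.3 (ii), (iv)] -/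
theorem signature_two_smul_hyperbolicSum_three : ((2 : ℤ) • hyperbolicSum 3).signature = 0 := by
  have h := signature_eq_of_equivalent ⟨twoHyperbolicSumNegIsometryEquiv⟩
  rw [signature_neg] at h
  omega

/-- **`σ(⟨−2⟩^{⊕8}) = −8`.** [cite: VanGeemenSarti2007, §1.5] -/
theorem signature_nikulinNodeForm : nikulinNodeForm.signature = -8 := by
  rw [(negDef_iff_signature_eq_neg_finrank isSymm_nikulinNodeForm nondegenerate_nikulinNodeForm.1).1
    negDef_nikulinNodeForm, Module.finrank_fin_fun]
  rfl

/-- **`σ(Λ₀) = σ(U(2)^{⊕3}) + σ(⟨−2⟩^{⊕8}) = −8`.** [cite: VanGeemenSarti2007, §1.10] [cite: Serre1973, Ch. V §1.3.7] -/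
theorem signature_vgsNodeForm : vgsNodeForm.signature = -8 := by
  rw [vgsNodeForm_eq_prod, signature_prod _ _ ((hyperbolicSum 3).isSymm_smul_of_isSymm 2 (isSymm_hyperbolicSum 3))
    isSymm_nikulinNodeForm, signature_two_smul_hyperbolicSum_three, signature_nikulinNodeForm]
  rfl

/-! ### §2 The seven half-vectors and the binary code of their residues -/

/-- **The numerators `w₀, …, w₆ ∈ U^{⊕3} ⊕ ℤ⁸` of the glue vectors `wₖ/2`**: `w₀ = N₁ + ⋯ + N₈` (so `w₀/2 = N̂`
and `Λ₀ + ℤN̂ = U(2)^{⊕3} ⊕ N`), and the six printed ones `e₁ + (N₁+N₂+N₃+N₈)`, `e₂ + (N₁+N₅+N₆+N₈)`,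
`e₃ + (N₂+N₆+N₇+N₈)`, `f₁ + (N₁+N₂+N₄+N₈)`, `f₂ + (N₁+N₅+N₇+N₈)`, `f₃ + (N₃+N₄+N₅+N₈)` (indices shifted to
`0, …, 7`). [cite: VanGeemenSarti2007, §1.10 (Lemma 1.10)] [cite: VanGeemenSarti2007, §1.5 ("`N̂ := (N₁ + … + N₈)/2`")] -/
def vgsGlueVec : Fin 7 → VGSCarrier
  | 0 => ((0, 0), 1)
  | 1 => ((Pi.single 0 1, 0), fun j ↦ if j = 0 ∨ j = 1 ∨ j = 2 ∨ j = 7 then 1 else 0)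
  | 2 => ((Pi.single 1 1, 0), fun j ↦ if j = 0 ∨ j = 4 ∨ j = 5 ∨ j = 7 then 1 else 0)
  | 3 => ((Pi.single 2 1, 0), fun j ↦ if j = 1 ∨ j = 5 ∨ j = 6 ∨ j = 7 then 1 else 0)
  | 4 => ((0, Pi.single 0 1), fun j ↦ if j = 0 ∨ j = 1 ∨ j = 3 ∨ j = 7 then 1 else 0)
  | 5 => ((0, Pi.single 1 1), fun j ↦ if j = 0 ∨ j = 4 ∨ j = 6 ∨ j = 7 then 1 else 0)
  | 6 => ((0, Pi.single 2 1), fun j ↦ if j = 2 ∨ j = 3 ∨ j = 4 ∨ j = 7 then 1 else 0)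

/-- **The residues `r(wₖ/2) ∈ 𝔽₂^{14}`** (coordinates of `wₖ` mod `2`): the generators of the gluing code.
[cite: VanGeemenSarti2007, §1.10] -/
def vgsGen (k : Fin 7) (i : VGSIndex) : ZMod 2 :=
  ((vgsCoord (vgsGlueVec k) i : ℤ) : ZMod 2)

/-- The code word with coefficients `c ∈ 𝔽₂⁷`: `Σₖ cₖ r(wₖ/2)`. [cite: VanGeemenSarti2007, §1.10] -/
def vgsWord (c : Fin 7 → ZMod 2) (i : VGSIndex) : ZMod 2 :=
  ∑ k, c k * vgsGen k i

/-- `c ↦ Σₖ cₖ r(wₖ/2)` as a `ℤ`-linear map `𝔽₂⁷ → 𝔽₂^{14}`. [cite: VanGeemenSarti2007, §1.10] -/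
def vgsCodeMap : (Fin 7 → ZMod 2) →ₗ[ℤ] (VGSIndex → ZMod 2) :=
  AddMonoidHom.toIntLinearMap
    { toFun := vgsWord
      map_zero' := by funext i; simp [vgsWord]
      map_add' := fun c c' ↦ by funext i; simp [vgsWord, add_mul, Finset.sum_add_distrib] }

/-- `vgsCodeMap c = vgsWord c`. [cite: VanGeemenSarti2007, §1.10] -/
@[simp] theorem vgsCodeMap_apply (c : Fin 7 → ZMod 2) : vgsCodeMap c = vgsWord c := rfl

/-- **The gluing code** `C = ⟨r(w₀/2), …, r(w₆/2)⟩ ⊂ 𝔽₂^{14}`. [cite: VanGeemenSarti2007, §1.10] -/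
def vgsCode : Submodule ℤ (VGSIndex → ZMod 2) :=
  LinearMap.range vgsCodeMap

set_option maxRecDepth 8000 in
/-- **The seven residues are linearly independent** (a finite check over the `2⁷` coefficient vectors).
[cite: VanGeemenSarti2007, §1.10] -/
theorem vgsWord_injective : ∀ c : Fin 7 → ZMod 2, vgsWord c = 0 → c = 0 := by
  decide

/-- `c ↦ Σₖ cₖ r(wₖ/2)` is injective. [cite: VanGeemenSarti2007, §1.10] -/
theorem vgsCodeMap_injective : Injective vgsCodeMap := by
  intro c c' h
  have h0 : vgsWord (c - c') = 0 := by
    have := map_sub vgsCodeMap c c'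
    rw [h, sub_self] at this
    exact this
  exact sub_eq_zero.1 (vgsWord_injective _ h0)

/-- **`|C| = 2⁷`.** [cite: VanGeemenSarti2007, §1.10] -/
theorem natCard_vgsCode : Nat.card vgsCode = 2 ^ 7 := by
  rw [vgsCode, ← Nat.card_congr (LinearEquiv.ofInjective _ vgsCodeMap_injective).toEquiv, Nat.card_pi, Nat.card_zmod,
    Finset.prod_const, Finset.card_univ, Fintype.card_fin]

set_option maxRecDepth 8000 in
/-- **The code is `q`-isotropic**: for every word `x = (u; v; n) ∈ C ⊂ 𝔽₂³ ⊕ 𝔽₂³ ⊕ 𝔽₂⁸`, with `{0,1}`-lifts,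
`4 ∣ 2 u·v − #{j | nⱼ = 1}` — i.e. `(x̃/2)² = (2u·v − #nodes)·2/4 ∈ 2ℤ` (a finite check over the `128` words; e.g.
`N̂² = −4`, `((e₁ + N₁+N₂+N₃+N₈)/2)² = −2`, `((e₁+f₁+…)/2)²` even). [cite: VanGeemenSarti2007, §1.10] -/
theorem four_dvd_vgsWord : ∀ c : Fin 7 → ZMod 2,
    (4 : ℤ) ∣ 2 * ∑ i : Fin 3, ((vgsWord c (Sum.inl (Sum.inl i))).val : ℤ) * (vgsWord c (Sum.inl (Sum.inr i))).val -
      ∑ j : Fin 8, ((vgsWord c (Sum.inr j)).val : ℤ) := by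
  decide

/-- Each generator is a code word (`r(wₖ/2) = vgsCodeMap δₖ`). [cite: VanGeemenSarti2007, §1.10] -/
theorem vgsGen_mem_vgsCode (k : Fin 7) : vgsGen k ∈ vgsCode := by
  refine ⟨Pi.single k 1, funext fun i ↦ ?_⟩
  rw [vgsCodeMap_apply, vgsWord, Finset.sum_eq_single k (fun j _ hj ↦ by rw [Pi.single_eq_of_ne hj, zero_mul])
    (fun h ↦ (h (Finset.mem_univ k)).elim), Pi.single_eq_same, one_mul]

/-- **`C` is the `ℤ`-span of the seven residues.** [cite: VanGeemenSarti2007, §1.10] -/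
theorem span_range_vgsGen : Submodule.span ℤ (Set.range vgsGen) = vgsCode := by
  refine le_antisymm (Submodule.span_le.2 ?_) ?_
  · rintro _ ⟨k, rfl⟩
    exact vgsGen_mem_vgsCode k
  · rintro _ ⟨c, rfl⟩
    have h : vgsCodeMap c = ∑ k, ((c k).val : ℤ) • vgsGen k := by
      funext i
      rw [vgsCodeMap_apply, vgsWord, Finset.sum_apply]
      refine Finset.sum_congr rfl fun k _ ↦ ?_
      rw [Pi.smul_apply, zsmul_eq_mul, Int.cast_natCast, ZMod.natCast_zmod_val]
    rw [h]
    exact Submodule.sum_mem _ fun k _ ↦ Submodule.smul_mem _ _ (Submodule.subset_span ⟨k, rfl⟩)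

/-! ### §3 The van Geemen–Sarti lattice `vgsLattice = Λ₀ + Σₖ ℤ·(wₖ/2)` and its subgroup `H ⊂ A_{Λ₀}` -/

/-- **The sublattice of `(U(2)³ ⊕ N) ⊗ ℚ` generated by `U(2)³ ⊕ N` and the six half-vectors** — in `Λ₀^*`:
`i_{Λ₀}(Λ₀) + Σₖ ℤ·(wₖ/2 . _)` with `(wₖ/2 . _)_{Λ₀} = vgsBaseForm wₖ` (`w₀/2 = N̂` supplies `N ⊃ ⊕ ℤNᵢ`).
[cite: VanGeemenSarti2007, §1.10 (Lemma 1.10)] -/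
def vgsLattice : Submodule ℤ (Module.Dual ℤ VGSCarrier) :=
  LinearMap.range vgsNodeForm ⊔ Submodule.span ℤ (Set.range fun k ↦ vgsBaseForm (vgsGlueVec k))

/-- `Λ₀ ⊂ vgsLattice`. [cite: VanGeemenSarti2007, §1.10] -/
theorem range_vgsNodeForm_le : LinearMap.range vgsNodeForm ≤ vgsLattice :=
  le_sup_left

/-- The half-vectors lie in `vgsLattice`. [cite: VanGeemenSarti2007, §1.10] -/
theorem vgsBaseForm_glueVec_mem (k : Fin 7) : vgsBaseForm (vgsGlueVec k) ∈ vgsLattice :=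
  Submodule.mem_sup_right (Submodule.subset_span ⟨k, rfl⟩)

/-- `2 · (wₖ/2) = wₖ ∈ Λ₀`. [cite: VanGeemenSarti2007, §1.10 ("each divided by two")] -/
theorem two_smul_vgsBaseForm_glueVec (k : Fin 7) : (2 : ℤ) • vgsBaseForm (vgsGlueVec k) = vgsNodeForm (vgsGlueVec k) :=
  rfl

/-- **The residue map `r : A_{Λ₀} = Λ₀^*/Λ₀ ⥲ 𝔽₂^{14}`** (coordinates of the numerator mod `2`).
[cite: VanGeemenSarti2007, §1.10] [cite: Huybrechts2016K3, Ch. 14 §0.3 (iv)] -/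
def vgsResidue : vgsNodeForm.discriminantGroup ≃ₗ[ℤ] (VGSIndex → ZMod 2) :=
  vgsBaseForm.discriminantGroupSmulEquivPiZMod 2 isUnimodular_vgsBaseForm vgsBasis

/-- `r[(w/2 . _)] = (coordinates of w) mod 2`. [cite: VanGeemenSarti2007, §1.10] -/
theorem vgsResidue_mk (w : VGSCarrier) :
    vgsResidue (Submodule.Quotient.mk (vgsBaseForm w)) = fun i ↦ ((vgsCoord w i : ℤ) : ZMod 2) := by
  have h := vgsBaseForm.discriminantGroupSmulEquivPiZMod_mk_apply 2 isUnimodular_vgsBaseForm vgsBasis w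
  simp only [vgsBasis_repr] at h
  exact h

/-- `r[(wₖ/2 . _)] = vgsGen k`. [cite: VanGeemenSarti2007, §1.10] -/
theorem vgsResidue_mk_glueVec (k : Fin 7) :
    vgsResidue (Submodule.Quotient.mk (vgsBaseForm (vgsGlueVec k))) = vgsGen k :=
  vgsResidue_mk _

/-- **`H := vgsLattice/Λ₀ = ⟨[w₀/2], …, [w₆/2]⟩ ⊂ A_{Λ₀}`.** [cite: VanGeemenSarti2007, §1.10 ("`L` is determined by the image of `L/M` in … `A_M`")] -/
theorem map_mkQ_vgsLattice :
    vgsLattice.map vgsNodeForm.discriminantGroupMkQ =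
      Submodule.span ℤ (Set.range fun k ↦ (Submodule.Quotient.mk (vgsBaseForm (vgsGlueVec k)) : vgsNodeForm.discriminantGroup)) := by
  have h0 : (LinearMap.range vgsNodeForm).map vgsNodeForm.discriminantGroupMkQ = ⊥ := Submodule.mkQ_map_self _
  rw [vgsLattice, Submodule.map_sup, h0, bot_sup_eq, Submodule.map_span, ← Set.range_comp]
  rfl

/-- **`r(H) = C`.** [cite: VanGeemenSarti2007, §1.10] -/
theorem map_vgsResidue_map_mkQ_vgsLattice :
    (vgsLattice.map vgsNodeForm.discriminantGroupMkQ).map vgsResidue.toLinearMap = vgsCode := by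
  rw [map_mkQ_vgsLattice, Submodule.map_span, ← Set.range_comp]
  have h : (⇑vgsResidue.toLinearMap ∘ fun k ↦
      (Submodule.Quotient.mk (vgsBaseForm (vgsGlueVec k)) : vgsNodeForm.discriminantGroup)) = vgsGen :=
    funext fun k ↦ vgsResidue_mk_glueVec k
  rw [h, span_range_vgsGen]

/-- **`|H| = 2⁷`.** [cite: VanGeemenSarti2007, §1.10] -/
theorem natCard_map_mkQ_vgsLattice : Nat.card (vgsLattice.map vgsNodeForm.discriminantGroupMkQ) = 2 ^ 7 := by
  rw [← natCard_vgsCode, ← map_vgsResidue_map_mkQ_vgsLattice]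
  exact Nat.card_congr (vgsResidue.submoduleMap _).toEquiv

/-- `vgsLattice = L_H`. [cite: VanGeemenSarti2007, §1.10] [cite: Huybrechts2016K3, Ch. 14 §0.2] -/
theorem overlattice_map_mkQ_vgsLattice :
    vgsNodeForm.overlattice (vgsLattice.map vgsNodeForm.discriminantGroupMkQ) = vgsLattice :=
  vgsNodeForm.overlattice_map_mkQ range_vgsNodeForm_le

/-- **`q_{Λ₀}` vanishes on `H`**: a class `x ∈ H` with residue the code word `(u; v; n)` is represented by the
`{0,1}`-lift `w`, and `(w/2)² = (2u·v − #nodes)/2 ∈ 2ℤ`. [cite: VanGeemenSarti2007, §1.10 ("the discriminant form … is identically zero on the subgroup `L/M`")] -/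
theorem discriminantQuad_eq_zero_of_mem_map_mkQ_vgsLattice (x : vgsNodeForm.discriminantGroup)
    (hx : x ∈ vgsLattice.map vgsNodeForm.discriminantGroupMkQ) :
    vgsNodeForm.discriminantQuad nondegenerate_vgsNodeForm isSymm_vgsNodeForm isEven_vgsNodeForm x = 0 := by
  have hx' : vgsResidue x ∈ vgsCode := by
    rw [← map_vgsResidue_map_mkQ_vgsLattice]
    exact Submodule.mem_map_of_mem hx
  obtain ⟨c, hc⟩ := hx'
  -- the `{0,1}`-lift of the word
  set w : VGSCarrier := ((fun i ↦ ((vgsWord c (Sum.inl (Sum.inl i))).val : ℤ),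
    fun i ↦ ((vgsWord c (Sum.inl (Sum.inr i))).val : ℤ)), fun j ↦ ((vgsWord c (Sum.inr j)).val : ℤ)) with hw
  have hxw : x = Submodule.Quotient.mk (vgsBaseForm w) := by
    apply vgsResidue.injective
    rw [vgsResidue_mk, ← hc, vgsCodeMap_apply]
    funext i
    rcases i with (i | i) | j
    · change vgsWord c _ = (((vgsWord c (Sum.inl (Sum.inl i))).val : ℤ) : ZMod 2)
      rw [Int.cast_natCast, ZMod.natCast_zmod_val]
    · change vgsWord c _ = (((vgsWord c (Sum.inl (Sum.inr i))).val : ℤ) : ZMod 2)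
      rw [Int.cast_natCast, ZMod.natCast_zmod_val]
    · change vgsWord c _ = (((vgsWord c (Sum.inr j)).val : ℤ) : ZMod 2)
      rw [Int.cast_natCast, ZMod.natCast_zmod_val]
  rw [hxw]
  change ((2 : ℤ) • vgsBaseForm).discriminantQuad _ _ _ (vgsBaseForm.twistIncl 2 (Submodule.Quotient.mk w)) = 0
  rw [vgsBaseForm.discriminantQuad_smul_twistIncl_mk 2 nondegenerate_vgsBaseForm two_ne_zero, vgsBaseForm_apply,
    AddCircle.coe_eq_zero_iff]
  obtain ⟨m, hm⟩ := four_dvd_vgsWord c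
  have hval : ∀ t : ZMod 2, (t.val : ℤ) * t.val = t.val := by decide
  have h1 : w.1.1 ⬝ᵥ w.1.2 = ∑ i : Fin 3, ((vgsWord c (Sum.inl (Sum.inl i))).val : ℤ) * (vgsWord c (Sum.inl (Sum.inr i))).val := rfl
  have h2 : w.1.2 ⬝ᵥ w.1.1 = ∑ i : Fin 3, ((vgsWord c (Sum.inl (Sum.inl i))).val : ℤ) * (vgsWord c (Sum.inl (Sum.inr i))).val := by
    rw [dotProduct_comm]; rfl
  have h3 : w.2 ⬝ᵥ w.2 = ∑ j : Fin 8, ((vgsWord c (Sum.inr j)).val : ℤ) := by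
    change ∑ j : Fin 8, ((vgsWord c (Sum.inr j)).val : ℤ) * (vgsWord c (Sum.inr j)).val = _
    exact Finset.sum_congr rfl fun j _ ↦ hval _
  refine ⟨m, ?_⟩
  rw [h1, h2, h3, zsmul_eq_mul]
  have hm' : ((2 * ∑ i : Fin 3, ((vgsWord c (Sum.inl (Sum.inl i))).val : ℤ) * (vgsWord c (Sum.inl (Sum.inr i))).val -
      ∑ j : Fin 8, ((vgsWord c (Sum.inr j)).val : ℤ) : ℤ) : ℚ) = ((4 * m : ℤ) : ℚ) := by rw [hm]
  push_cast at hm' ⊢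
  linarith

/-- **The `ℚ`-valued pairing is integral on `vgsLattice`.** [cite: VanGeemenSarti2007, §1.10 ("`b = b_M` extends to a `ℤ`-valued bilinear form on `L`")] -/
theorem vgsLattice_integral : ∀ f ∈ vgsLattice, ∀ g ∈ vgsLattice, ∃ n : ℤ, vgsNodeForm.dualForm f g = n := by
  have h := ((vgsNodeForm.forall_discriminantQuad_eq_zero_iff_integral_even nondegenerate_vgsNodeForm isSymm_vgsNodeForm
    isEven_vgsNodeForm _).1 discriminantQuad_eq_zero_of_mem_map_mkQ_vgsLattice).1
  rwa [overlattice_map_mkQ_vgsLattice] at h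

/-- `(f . f) ∈ 2ℤ` on `vgsLattice`. [cite: VanGeemenSarti2007, §1.10] -/
theorem vgsLattice_even : ∀ f ∈ vgsLattice, ∃ k : ℤ, vgsNodeForm.dualForm f f = 2 * k := by
  have h := ((vgsNodeForm.forall_discriminantQuad_eq_zero_iff_integral_even nondegenerate_vgsNodeForm isSymm_vgsNodeForm
    isEven_vgsNodeForm _).1 discriminantQuad_eq_zero_of_mem_map_mkQ_vgsLattice).2
  rwa [overlattice_map_mkQ_vgsLattice] at h

/-! ### §4 The glued lattice `Γ`: even, unimodular, rank `14`, signature `−8`; Lemma 1.10 -/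

/-- **The lattice `Γ` of Lemma 1.10** (the integral form of `vgsLattice`). [cite: VanGeemenSarti2007, §1.10 (Lemma 1.10)] -/
def vgsOverlatticeForm : BilinForm ℤ vgsLattice :=
  vgsNodeForm.integralForm vgsLattice vgsLattice_integral

/-- `Γ` is symmetric. [cite: VanGeemenSarti2007, §1.10] -/
theorem isSymm_vgsOverlatticeForm : vgsOverlatticeForm.IsSymm :=
  vgsNodeForm.isSymm_integralForm nondegenerate_vgsNodeForm isSymm_vgsNodeForm _ _

/-- `Γ` is nondegenerate. [cite: VanGeemenSarti2007, §1.10] -/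
theorem nondegenerate_vgsOverlatticeForm : vgsOverlatticeForm.Nondegenerate :=
  vgsNodeForm.nondegenerate_integralForm nondegenerate_vgsNodeForm isSymm_vgsNodeForm _ range_vgsNodeForm_le _

/-- **`Γ` is even.** [cite: VanGeemenSarti2007, §1.10 (`Γ ≅ U³ ⊕ E₈(−1)` is even)] -/
theorem isEven_vgsOverlatticeForm : vgsOverlatticeForm.IsEven :=
  (vgsNodeForm.isEven_integralForm_iff _ _).2 vgsLattice_even

/-- **`Γ` is unimodular: `|H|² = 2¹⁴ = |A_{Λ₀}|`.** [cite: VanGeemenSarti2007, §1.10] [cite: Huybrechts2016K3, Ch. 14 §0.2 ("`Λ` is unimodular if and only if `|H|² = |A_{Λ'}|`")] -/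
theorem isUnimodular_vgsOverlatticeForm : vgsOverlatticeForm.IsUnimodular := by
  rw [vgsOverlatticeForm, vgsNodeForm.isUnimodular_integralForm_iff nondegenerate_vgsNodeForm isSymm_vgsNodeForm _
    range_vgsNodeForm_le, natCard_map_mkQ_vgsLattice, natCard_discriminantGroup_vgsNodeForm]
  norm_num

/-- **`rk Γ = 14`.** [cite: VanGeemenSarti2007, §1.10] -/
theorem finrank_vgsLattice : finrank ℤ vgsLattice = 14 := by
  rw [vgsNodeForm.finrank_overlattice_eq nondegenerate_vgsNodeForm _ range_vgsNodeForm_le, finrank_vgsCarrier]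

/-- **`σ(Γ) = σ(Λ₀) = −8`.** [cite: VanGeemenSarti2007, §1.10] [cite: Serre1973, Ch. V §1.3.2] -/
theorem signature_vgsOverlatticeForm : vgsOverlatticeForm.signature = -8 := by
  rw [vgsOverlatticeForm, vgsNodeForm.signature_integralForm nondegenerate_vgsNodeForm isSymm_vgsNodeForm _
    range_vgsNodeForm_le, signature_vgsNodeForm]

/-- `Λ₀ ⊂ Γ` is a sublattice: `(i x . i y)_Γ = (x . y)_{Λ₀}`. [cite: VanGeemenSarti2007, §1.10] -/
theorem vgsOverlatticeForm_toOverlattice (x y : VGSCarrier) :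
    vgsOverlatticeForm (vgsNodeForm.toOverlattice vgsLattice range_vgsNodeForm_le x)
      (vgsNodeForm.toOverlattice vgsLattice range_vgsNodeForm_le y) = vgsNodeForm x y :=
  vgsNodeForm.integralForm_toOverlattice nondegenerate_vgsNodeForm isSymm_vgsNodeForm _ _ _ x y

/-- **`Γ` is indefinite** (`(e₁ + f₁)² = 4 > 0 > −2 = N₁²`). [cite: VanGeemenSarti2007, §1.10] -/
theorem isIndefinite_vgsOverlatticeForm : vgsOverlatticeForm.IsIndefinite := by
  refine isIndefinite_of_apply_self_neg_of_pos
    (x := vgsNodeForm.toOverlattice vgsLattice range_vgsNodeForm_le ((0, 0), Pi.single 0 1))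
    (y := vgsNodeForm.toOverlattice vgsLattice range_vgsNodeForm_le ((Pi.single 0 1, Pi.single 0 1), 0)) ?_ ?_
  · rw [vgsOverlatticeForm_toOverlattice, smul_apply_apply, vgsBaseForm_apply]
    simp
  · rw [vgsOverlatticeForm_toOverlattice, smul_apply_apply, vgsBaseForm_apply]
    simp

/-- **`n₊(Γ) = 3`, `n₋(Γ) = 11`.** [cite: VanGeemenSarti2007, §1.10] -/
theorem sigPos_sigNeg_vgsOverlatticeForm :
    sigPos vgsOverlatticeForm.toQuadraticMap = 3 ∧ sigNeg vgsOverlatticeForm.toQuadraticMap = 11 := by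
  have h1 := sigPos_add_sigNeg_eq_finrank_holds vgsOverlatticeForm isUnimodular_vgsOverlatticeForm isSymm_vgsOverlatticeForm
  have h2 : vgsOverlatticeForm.signature =
      (sigPos vgsOverlatticeForm.toQuadraticMap : ℤ) - sigNeg vgsOverlatticeForm.toQuadraticMap := rfl
  rw [finrank_vgsLattice] at h1
  rw [signature_vgsOverlatticeForm] at h2
  omega

/-- **van Geemen–Sarti, Lemma 1.10: `Γ ≃ U^{⊕3} ⊕ E₈(−1)`** — the lattice generated by `U(2)^{⊕3} ⊕ N` and the six
half-vectors is isometric to `E₈(−1) ⊕ U^{⊕3}` (in the lattice files' model; by Milnor's classification of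
indefinite even unimodular lattices applied to the even unimodular `Γ` of rank `14` and signature `−8`).
[cite: VanGeemenSarti2007, §1.10 (Lemma 1.10)] [cite: Huybrechts2016K3, Ch. 14 Cor. 1.3 (i)] -/
theorem vgsOverlatticeForm_equivalent :
    vgsOverlatticeForm.Equivalent ((LinearMap.BilinForm.pi fun _ : Fin 1 ↦ -e8Form).prod (hyperbolicSum 3)) := by
  obtain ⟨m, hm, h⟩ := exists_equivalent_pi_neg_e8Form_prod_hyperbolicSum vgsOverlatticeForm isSymm_vgsOverlatticeForm
    isUnimodular_vgsOverlatticeForm isEven_vgsOverlatticeForm isIndefinite_vgsOverlatticeForm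
    (by rw [signature_vgsOverlatticeForm]; norm_num)
  rw [signature_vgsOverlatticeForm] at hm
  obtain rfl : m = 1 := by omega
  rw [sigPos_sigNeg_vgsOverlatticeForm.1] at h
  exact h

/-! ### §5 "such that the image of `N` is primitive": `Γ ∩ N_ℚ = N` -/

set_option maxRecDepth 8000 in
/-- The code words with vanishing `U`-part are `0` and `r(N̂) = (0; 0; 1, …, 1)` (a finite check).
[cite: VanGeemenSarti2007, §1.10 ("such that the image of `N` is primitive in `U³ ⊕ E₈(−1)`")] -/
theorem vgsWord_nodes_of_uPart_eq_zero : ∀ c : Fin 7 → ZMod 2, (∀ i : Fin 3 ⊕ Fin 3, vgsWord c (Sum.inl i) = 0) →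
    (∀ j : Fin 8, vgsWord c (Sum.inr j) = 0) ∨ ∀ j : Fin 8, vgsWord c (Sum.inr j) = 1 := by
  decide

/-- `N ⊂ Γ`: `N̂ = w₀/2 ∈ Γ` and `Nᵢ ∈ Λ₀ ⊂ Γ`; in numerators, `(Σ nⱼNⱼ)/2 ∈ Γ` whenever all `nⱼ` are even or all
are odd. [cite: VanGeemenSarti2007, §1.5 ("`N = ⟨N₁, …, N₈, N̂⟩`"), §1.10] -/
theorem vgsBaseForm_nodes_mem_vgsLattice {n : Fin 8 → ℤ} (h : (∀ j, Even (n j)) ∨ ∀ j, Odd (n j)) :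
    vgsBaseForm ((0, 0), n) ∈ vgsLattice := by
  rcases h with h | h
  · choose m hm using h
    have hn : ((0, 0), n) = (2 : ℤ) • (((0, 0), m) : VGSCarrier) := by
      refine Prod.ext (by simp) (funext fun j ↦ ?_)
      change n j = 2 * m j
      rw [hm j, two_mul]
    rw [hn, map_smul]
    exact range_vgsNodeForm_le ⟨((0, 0), m), rfl⟩
  · choose m hm using h
    have hn : ((0, 0), n) = vgsGlueVec 0 + (2 : ℤ) • (((0, 0), m) : VGSCarrier) := by
      refine Prod.ext (by simp [vgsGlueVec]) (funext fun j ↦ ?_)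
      change n j = 1 + 2 * m j
      rw [hm j]; ring
    rw [hn, map_add, map_smul]
    exact add_mem (vgsBaseForm_glueVec_mem 0) (range_vgsNodeForm_le ⟨((0, 0), m), rfl⟩)

/-- **The image of `N` is primitive in `Γ`: `Γ ∩ N_ℚ = N`** — a node-supported half-vector `(Σ nⱼNⱼ)/2` lies in `Γ`
iff all `nⱼ` are even or all are odd, i.e. iff it lies in `N = ⟨Nᵢ, N̂⟩`. [cite: VanGeemenSarti2007, §1.10 ("such that the image of `N` is primitive in `U³ ⊕ E₈(−1)`")] -/
theorem vgsBaseForm_nodes_mem_vgsLattice_iff (n : Fin 8 → ℤ) :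
    vgsBaseForm ((0, 0), n) ∈ vgsLattice ↔ (∀ j, Even (n j)) ∨ ∀ j, Odd (n j) := by
  refine ⟨fun h ↦ ?_, vgsBaseForm_nodes_mem_vgsLattice⟩
  -- the residue of `(Σ nⱼNⱼ)/2` is a code word with vanishing `U`-part
  have h1 : vgsResidue (Submodule.Quotient.mk (vgsBaseForm ((0, 0), n))) ∈ vgsCode := by
    rw [← map_vgsResidue_map_mkQ_vgsLattice]
    exact Submodule.mem_map_of_mem (Submodule.mem_map_of_mem h)
  obtain ⟨c, hc⟩ := h1
  rw [vgsCodeMap_apply, vgsResidue_mk] at hc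
  have hu : ∀ i : Fin 3 ⊕ Fin 3, vgsWord c (Sum.inl i) = 0 := fun i ↦ by
    have := congrFun hc (Sum.inl i)
    rcases i with i | i <;> simpa [vgsCoord] using this
  have hnode : ∀ j : Fin 8, vgsWord c (Sum.inr j) = ((n j : ℤ) : ZMod 2) := fun j ↦ by
    have := congrFun hc (Sum.inr j)
    simpa [vgsCoord] using this
  rcases vgsWord_nodes_of_uPart_eq_zero c hu with h0 | h0
  · left
    intro j
    have := h0 j
    rw [hnode j, ZMod.intCast_zmod_eq_zero_iff_dvd] at this
    exact even_iff_two_dvd.2 (by exact_mod_cast this)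
  · right
    intro j
    have := h0 j
    rw [hnode j] at this
    rw [← Int.not_even_iff_odd, even_iff_two_dvd]
    intro hd
    have h2 : ((n j : ℤ) : ZMod 2) = 0 := (ZMod.intCast_zmod_eq_zero_iff_dvd (n j) 2).2 (by exact_mod_cast hd)
    rw [h2] at this
    exact zero_ne_one this

end Literature.AlgebraicGeometry.Surfaces
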